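import Summits.PneNP.PneNP.Theorems.KarlinRubinMonotoneBlindCnf

/-!
# Route KarlinRubin, crux `MonotoneBlind` (stmt-PneNP-18027): dropping the wide clauses of an OR of CNFs

The lead's registered helper `stub_weakBlindOrCnfForm` (line `Sketch`): restricting every CNF of an OR of `m` CNFs with
`≤ M` clauses each to its clauses of `≤ L` slots enlarges the acceptance event by at most the event "some wide clause is
entirely off", of `G(n,1/2)`-probability `≤ m M 2^{-(L+1)}` (union bound; a clause of `> L` slots is off with probability
`2^{-#S} ≤ 2^{-(L+1)}`, `erdosRenyiHalf_forall_eq_false_le`).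

All `--supports stmt-PneNP-18027`; no definitions.
-/

set_option linter.dupNamespace false -- `Summit.PneNP.PneNP.…`: summit = sub-problem (D-0017)

namespace Summit.PneNP.PneNP.Theorems

open Finset
open scoped ENNReal
open Literature.Computability.Complexity
open Literature.Probability.RandomGraphs.PlantedClique

variable {n : ℕ}

/-- **Dropping wide clauses of an OR of CNFs costs `≤ m M 2^{-(L+1)}` under `G(n,1/2)`.** [folklore] -/
theorem orCnf_narrow_le (m M L : ℕ) (𝓒 : Fin m → Finset (Finset (⊤ : SimpleGraph (Fin n)).edgeSet))
    (hM : ∀ i, #(𝓒 i) ≤ M) :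
    (erdosRenyiHalf n).toOuterMeasure {x | ∃ i, ∀ S ∈ (𝓒 i).filter (fun S => #S ≤ L), ∃ e ∈ S, x e = true} ≤
      (erdosRenyiHalf n).toOuterMeasure {x | ∃ i, ∀ S ∈ 𝓒 i, ∃ e ∈ S, x e = true} +
        ((m * M : ℕ) : ℝ≥0∞) * 2⁻¹ ^ (L + 1) := by
  set P0 := erdosRenyiHalf n with hP0
  -- the covering
  have hcov : {x : EdgeVec n | ∃ i, ∀ S ∈ (𝓒 i).filter (fun S => #S ≤ L), ∃ e ∈ S, x e = true} ⊆
      {x | ∃ i, ∀ S ∈ 𝓒 i, ∃ e ∈ S, x e = true} ∪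
        ⋃ i ∈ (univ : Finset (Fin m)), ⋃ S ∈ (𝓒 i).filter (fun S => L + 1 ≤ #S),
          {x : EdgeVec n | ∀ e ∈ S, x e = false} := by
    intro x hx
    obtain ⟨i, hi⟩ := hx
    by_cases hfull : ∀ S ∈ 𝓒 i, ∃ e ∈ S, x e = true
    · exact Or.inl ⟨i, hfull⟩
    · push Not at hfull
      obtain ⟨S, hS, hdead⟩ := hfull
      have hwide : L + 1 ≤ #S := by
        by_contra hle
        obtain ⟨e, he, hxe⟩ := hi S (mem_filter.2 ⟨hS, by omega⟩)
        exact absurd hxe (by simp [hdead e he])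
      refine Or.inr ?_
      simp only [Set.mem_iUnion, Set.mem_setOf_eq]
      exact ⟨i, mem_univ _, S, mem_filter.2 ⟨hS, hwide⟩, fun e he => by simpa using hdead e he⟩
  -- the wide dead clauses
  have hwideI : ∀ i : Fin m, P0.toOuterMeasure (⋃ S ∈ (𝓒 i).filter (fun S => L + 1 ≤ #S),
      {x : EdgeVec n | ∀ e ∈ S, x e = false}) ≤ (M : ℝ≥0∞) * 2⁻¹ ^ (L + 1) := by
    intro i
    calc P0.toOuterMeasure (⋃ S ∈ (𝓒 i).filter (fun S => L + 1 ≤ #S), {x : EdgeVec n | ∀ e ∈ S, x e = false})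
        ≤ ∑ S ∈ (𝓒 i).filter (fun S => L + 1 ≤ #S), P0.toOuterMeasure {x : EdgeVec n | ∀ e ∈ S, x e = false} :=
          MeasureTheory.measure_biUnion_finset_le _ _
      _ ≤ ∑ S ∈ (𝓒 i).filter (fun S => L + 1 ≤ #S), (2⁻¹ : ℝ≥0∞) ^ (L + 1) := sum_le_sum fun S hS => by
          refine (erdosRenyiHalf_forall_eq_false_le S).trans ?_
          exact pow_le_pow_right_of_le_one' (ENNReal.inv_le_one.2 one_le_two) (mem_filter.1 hS).2
      _ = (#((𝓒 i).filter fun S => L + 1 ≤ #S) : ℝ≥0∞) * 2⁻¹ ^ (L + 1) := by rw [sum_const, nsmul_eq_mul]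
      _ ≤ (M : ℝ≥0∞) * 2⁻¹ ^ (L + 1) := by
          gcongr
          exact_mod_cast (card_le_card (filter_subset _ _)).trans (hM i)
  calc P0.toOuterMeasure {x | ∃ i, ∀ S ∈ (𝓒 i).filter (fun S => #S ≤ L), ∃ e ∈ S, x e = true}
      ≤ P0.toOuterMeasure ({x | ∃ i, ∀ S ∈ 𝓒 i, ∃ e ∈ S, x e = true} ∪
          ⋃ i ∈ (univ : Finset (Fin m)), ⋃ S ∈ (𝓒 i).filter (fun S => L + 1 ≤ #S),
            {x : EdgeVec n | ∀ e ∈ S, x e = false}) := P0.toOuterMeasure.mono hcov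
    _ ≤ P0.toOuterMeasure {x | ∃ i, ∀ S ∈ 𝓒 i, ∃ e ∈ S, x e = true} +
          P0.toOuterMeasure (⋃ i ∈ (univ : Finset (Fin m)), ⋃ S ∈ (𝓒 i).filter (fun S => L + 1 ≤ #S),
            {x : EdgeVec n | ∀ e ∈ S, x e = false}) := MeasureTheory.measure_union_le _ _
    _ ≤ P0.toOuterMeasure {x | ∃ i, ∀ S ∈ 𝓒 i, ∃ e ∈ S, x e = true} +
          ∑ i ∈ (univ : Finset (Fin m)), P0.toOuterMeasure (⋃ S ∈ (𝓒 i).filter (fun S => L + 1 ≤ #S),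
            {x : EdgeVec n | ∀ e ∈ S, x e = false}) :=
        add_le_add le_rfl (MeasureTheory.measure_biUnion_finset_le _ _)
    _ ≤ P0.toOuterMeasure {x | ∃ i, ∀ S ∈ 𝓒 i, ∃ e ∈ S, x e = true} +
          ∑ _i ∈ (univ : Finset (Fin m)), (M : ℝ≥0∞) * 2⁻¹ ^ (L + 1) := add_le_add le_rfl (sum_le_sum fun i _ => hwideI i)
    _ = _ := by rw [sum_const, card_univ, Fintype.card_fin, nsmul_eq_mul, Nat.cast_mul, mul_assoc]

/-- **stub_weakBlindOrCnfForm** (registered helper stub of the lead's line `Sketch`, crux stmt-PneNP-18027). [folklore] -/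
theorem stub_weakBlindOrCnfForm : ∀ (n m M L : ℕ) (𝓒 : Fin m → Finset (Finset ((⊤ : SimpleGraph (Fin n)).edgeSet))), (∀ i, #(𝓒 i) ≤ M) → (erdosRenyiHalf n).toOuterMeasure {x | ∃ i, ∀ S ∈ (𝓒 i).filter (fun S => #S ≤ L), ∃ e ∈ S, x e = true} ≤ (erdosRenyiHalf n).toOuterMeasure {x | ∃ i, ∀ S ∈ 𝓒 i, ∃ e ∈ S, x e = true} + ((m * M : ℕ) : ℝ≥0∞) * 2⁻¹ ^ (L + 1) :=
  fun _ m M L 𝓒 hM => orCnf_narrow_le m M L 𝓒 hM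

end Summit.PneNP.PneNP.Theorems
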